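/-
VALUE = THEOREM (Siegel transformations as products of two reflections; matrices, determinant,
group law), NOT summit progress (cell b2b-lgcu-borel, gen 24); the crux item
stmt-MatrixMultiplication-14079 is untouched.
-/
import Mathlib
import Literature.NumberTheory.EllipticCurves.BinaryQuarticDiscriminantFpCountProofs
import Summits.MatrixMultiplication.MatrixMultiplication.Theorems.SubgroupIdentityDesigns.Negative.ReflectionClassOrbitU
import Summits.MatrixMultiplication.MatrixMultiplication.Theorems.SubgroupIdentityDesigns.Negative.ReflectionClassPlane

/-!
# Siegel transformations are products of two reflections

VALUE = THEOREM (generic in the odd prime `p`), NOT summit progress; the crux item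
stmt-MatrixMultiplication-14079 is untouched and remains open.

Layer F4c-1 of the all-`p` proof of the unified reflection-class certificate (ORACLE-g24 §G24-1 (L1),
§G24-2/3): the algebra of the Siegel transformations `E_β = siegel x (β • y)` of
`ReflectionClassOrbitU` (`x ≠ 0` isotropic, `y ⊥ x` anisotropic):

* `siegelMat` / `siegelMat_mulVec` — the matrix `1 + y xᵀ − x yᵀ − (Q y/2) x xᵀ` of `siegel x y`;
* `refl_refl_apply` — **`R_y R_{y + (β Q(y)/2) x} = E_β`**: every Siegel transformation is a
  product of two reflections in vectors of `x^⊥` with the SAME value of `Q`; hence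
  `siegelGL x y β := R_y R_{y + (βQ(y)/2) x} ∈ GL₃(𝔽_p)` has matrix `siegelMat x (β • y)`
  (`coe_siegelGL`) and determinant `1` (`det_siegelGL`);
* `siegel_siegel` / `siegelGL_add` — the group law `E_α E_β = E_{α+β}`;
* `siegelGL_inj` — `β ↦ E_β` is injective;
* `not_class_of_perp_isotropic` — the mirrors available in `x^⊥` have the class of `−1`, which is
  NOT the class `σ` of the certificate (`−c` a non-square): the reason the membership
  `E_β ∈ classGroup p σ` (layer F4c-2) needs the four-reflection factorisation through an
  auxiliary anisotropic `w ∉ x^⊥`.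
HONEST SCOPE.  Matrix algebra only; by itself it excludes nothing.
-/

set_option linter.dupNamespace false

open scoped BigOperators Matrix

namespace Summit.MatrixMultiplication.MatrixMultiplication.Theorems.SubgroupIdentityDesigns.Negative
namespace ReflectionClassSiegel

open Summit.MatrixMultiplication.MatrixMultiplication.Theorems.LieRankDesigns.Negative (GLm Mat)
open ReflectionClassCertificate (V)
open NonsquareReflections (reflMat refl coe_refl reflMat_mul_self det_reflMat)
open ReflectionClassOrbitU (siegel siegel_smul_inj)
open ReflectionClassPlane (refl_apply)
open ReflectionClassSphere (neg_dot_isSquare_of_perp_isotropic)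
open Literature.NumberTheory.EllipticCurves.BinaryQuartic (two_ne_zero_zmod)

variable {p : ℕ} [hp : Fact p.Prime]

/-! ## The Siegel matrix -/

/-- The matrix `E_{x,y} = 1 + y xᵀ − x yᵀ − (Q(y)/2) x xᵀ` of `siegel x y`. -/
def siegelMat (x y : V p) : Mat p 3 :=
  1 + Matrix.vecMulVec y x - Matrix.vecMulVec x y - Matrix.vecMulVec (((y ⬝ᵥ y) / 2) • x) x

/-- `siegelMat x y` acts as `siegel x y`. -/
theorem siegelMat_mulVec (x y v : V p) : siegelMat x y *ᵥ v = siegel x y v := by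
  simp only [siegelMat, siegel, Matrix.add_mulVec, Matrix.sub_mulVec, Matrix.one_mulVec,
    Matrix.vecMulVec_mulVec, op_smul_eq_smul, smul_smul, dotProduct_comm x v, dotProduct_comm y v]
  rw [mul_comm (v ⬝ᵥ x) ((y ⬝ᵥ y) / 2)]

section Products

variable {x y : V p}

/-- The second mirror `y + κ x` has `Q = Q(y)` (`x` isotropic, `y ⊥ x`). -/
theorem dot_self_add_smul (hxx : x ⬝ᵥ x = 0) (hyx : y ⬝ᵥ x = 0) (κ : ZMod p) :
    (y + κ • x) ⬝ᵥ (y + κ • x) = y ⬝ᵥ y := by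
  have hxy : x ⬝ᵥ y = 0 := by rw [dotProduct_comm]; exact hyx
  simp only [add_dotProduct, dotProduct_add, smul_dotProduct, dotProduct_smul, smul_eq_mul, hxx,
    hyx, hxy, mul_zero, add_zero]

/-- **`R_y R_{y + (βQ(y)/2) x} v = E_β v`**: a Siegel transformation is the product of the
reflections in `y` and in `y + (β Q(y)/2) x` (`p ≠ 2`, `x` isotropic, `y ⊥ x`, `Q(y) ≠ 0`). -/
theorem refl_refl_apply (hp2 : p ≠ 2) (hxx : x ⬝ᵥ x = 0) (hyx : y ⬝ᵥ x = 0) (hy : y ⬝ᵥ y ≠ 0)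
    (β : ZMod p) (v : V p) :
    reflMat y *ᵥ (reflMat (y + (β * (y ⬝ᵥ y) / 2) • x) *ᵥ v) = siegel x (β • y) v := by
  have h2 : (2 : ZMod p) ≠ 0 := two_ne_zero_zmod hp2
  have hxy : x ⬝ᵥ y = 0 := by rw [dotProduct_comm]; exact hyx
  rw [refl_apply, refl_apply, dot_self_add_smul hxx hyx, siegel]
  simp only [add_dotProduct, dotProduct_add, dotProduct_sub, smul_dotProduct, dotProduct_smul,
    smul_eq_mul, hyx, mul_zero, add_zero, dotProduct_comm v x, dotProduct_comm v y, smul_add,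
    smul_smul]
  match_scalars <;> field_simp <;> ring

/-- The matrix identity `R_y R_{y + (βQ(y)/2) x} = siegelMat x (β • y)`. -/
theorem reflMat_mul_reflMat (hp2 : p ≠ 2) (hxx : x ⬝ᵥ x = 0) (hyx : y ⬝ᵥ x = 0)
    (hy : y ⬝ᵥ y ≠ 0) (β : ZMod p) :
    reflMat y * reflMat (y + (β * (y ⬝ᵥ y) / 2) • x) = siegelMat x (β • y) := by
  refine Matrix.ext_iff_mulVec.mpr fun v => ?_
  rw [← Matrix.mulVec_mulVec, refl_refl_apply hp2 hxx hyx hy, siegelMat_mulVec]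

/-! ## The Siegel elements of `GL₃(𝔽_p)` -/

/-- `E_β` as an element of `GL₃(𝔽_p)`: the product of the two reflections. -/
def siegelGL (x y : V p) (β : ZMod p) : GLm p 3 := refl y * refl (y + (β * (y ⬝ᵥ y) / 2) • x)

/-- Matrix of `siegelGL`. -/
theorem coe_siegelGL (hp2 : p ≠ 2) (hxx : x ⬝ᵥ x = 0) (hyx : y ⬝ᵥ x = 0) (hy : y ⬝ᵥ y ≠ 0)
    (β : ZMod p) : ((siegelGL x y β : GLm p 3) : Mat p 3) = siegelMat x (β • y) := by
  rw [siegelGL, Units.val_mul, coe_refl, coe_refl, reflMat_mul_reflMat hp2 hxx hyx hy]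

/-- `siegelGL` acts as `siegel`. -/
theorem siegelGL_mulVec (hp2 : p ≠ 2) (hxx : x ⬝ᵥ x = 0) (hyx : y ⬝ᵥ x = 0) (hy : y ⬝ᵥ y ≠ 0)
    (β : ZMod p) (v : V p) :
    ((siegelGL x y β : GLm p 3) : Mat p 3) *ᵥ v = siegel x (β • y) v := by
  rw [coe_siegelGL hp2 hxx hyx hy, siegelMat_mulVec]

/-- `det E_β = 1`. -/
theorem det_siegelGL (hxx : x ⬝ᵥ x = 0) (hyx : y ⬝ᵥ x = 0) (hy : y ⬝ᵥ y ≠ 0) (β : ZMod p) :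
    ((siegelGL x y β : GLm p 3) : Mat p 3).det = 1 := by
  rw [siegelGL, Units.val_mul, coe_refl, coe_refl, Matrix.det_mul, det_reflMat y hy,
    det_reflMat _ (by rw [dot_self_add_smul hxx hyx]; exact hy)]
  ring

/-- `E_β` fixes `x`. -/
theorem siegelGL_mulVec_x (hp2 : p ≠ 2) (hxx : x ⬝ᵥ x = 0) (hyx : y ⬝ᵥ x = 0) (hy : y ⬝ᵥ y ≠ 0)
    (β : ZMod p) : ((siegelGL x y β : GLm p 3) : Mat p 3) *ᵥ x = x := by
  have hxy : x ⬝ᵥ y = 0 := by rw [dotProduct_comm]; exact hyx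
  rw [siegelGL_mulVec hp2 hxx hyx hy, siegel]
  simp [hxx, dotProduct_smul, hxy]

/-! ## The group law -/

/-- **`E_α (E_β v) = E_{α+β} v`** (`p ≠ 2`, `x` isotropic, `y ⊥ x`). -/
theorem siegel_siegel (hp2 : p ≠ 2) (hxx : x ⬝ᵥ x = 0) (hyx : y ⬝ᵥ x = 0) (α β : ZMod p)
    (v : V p) : siegel x (α • y) (siegel x (β • y) v) = siegel x ((α + β) • y) v := by
  have h2 : (2 : ZMod p) ≠ 0 := two_ne_zero_zmod hp2
  have hxy : x ⬝ᵥ y = 0 := by rw [dotProduct_comm]; exact hyx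
  simp only [siegel, add_dotProduct, sub_dotProduct, smul_dotProduct, dotProduct_smul, smul_eq_mul,
    hxx, hyx, hxy, mul_zero, add_zero, sub_zero]
  match_scalars <;> field_simp <;> ring

/-- The group law in `GL₃(𝔽_p)`: `E_α E_β = E_{α+β}`. -/
theorem siegelGL_add (hp2 : p ≠ 2) (hxx : x ⬝ᵥ x = 0) (hyx : y ⬝ᵥ x = 0) (hy : y ⬝ᵥ y ≠ 0)
    (α β : ZMod p) : siegelGL x y α * siegelGL x y β = siegelGL x y (α + β) := by
  refine Units.ext (Matrix.ext_iff_mulVec.mpr fun v => ?_)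
  rw [Units.val_mul, ← Matrix.mulVec_mulVec, siegelGL_mulVec hp2 hxx hyx hy,
    siegelGL_mulVec hp2 hxx hyx hy, siegelGL_mulVec hp2 hxx hyx hy, siegel_siegel hp2 hxx hyx]

/-- `E_0 = 1`. -/
theorem siegelGL_zero (hp2 : p ≠ 2) (hxx : x ⬝ᵥ x = 0) (hyx : y ⬝ᵥ x = 0) (hy : y ⬝ᵥ y ≠ 0) :
    siegelGL x y 0 = 1 := by
  refine Units.ext (Matrix.ext_iff_mulVec.mpr fun v => ?_)
  rw [siegelGL_mulVec hp2 hxx hyx hy, Units.val_one, Matrix.one_mulVec, zero_smul, siegel]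
  simp

/-- `E_{nβ} = E_β ^ n`. -/
theorem siegelGL_nsmul (hp2 : p ≠ 2) (hxx : x ⬝ᵥ x = 0) (hyx : y ⬝ᵥ x = 0) (hy : y ⬝ᵥ y ≠ 0)
    (β : ZMod p) (n : ℕ) : siegelGL x y ((n : ZMod p) * β) = siegelGL x y β ^ n := by
  induction n with
  | zero => rw [Nat.cast_zero, zero_mul, pow_zero, siegelGL_zero hp2 hxx hyx hy]
  | succ n ih =>
    rw [pow_succ, ← ih, siegelGL_add hp2 hxx hyx hy, Nat.cast_succ, add_mul, one_mul]

/-- **A subgroup containing one `E_β`, `β ≠ 0`, contains every `E_α`.** -/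
theorem siegelGL_mem_of_mem (hp2 : p ≠ 2) (hxx : x ⬝ᵥ x = 0) (hyx : y ⬝ᵥ x = 0) (hy : y ⬝ᵥ y ≠ 0)
    {H : Subgroup (GLm p 3)} {β : ZMod p} (hβ : β ≠ 0) (h : siegelGL x y β ∈ H) (α : ZMod p) :
    siegelGL x y α ∈ H := by
  have hα : α = (((α / β : ZMod p).val : ℕ) : ZMod p) * β := by
    rw [ZMod.natCast_zmod_val, div_mul_cancel₀ _ hβ]
  rw [hα, siegelGL_nsmul hp2 hxx hyx hy]
  exact pow_mem h _

/-- **Freeness**: `β ↦ E_β` is injective (`−c` a non-square supplies `ω` with `ω·x ≠ 0`; here we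
only need some `v` with `v·x ≠ 0`, which exists as `x ≠ 0`). -/
theorem siegelGL_inj (hp2 : p ≠ 2) (hx0 : x ≠ 0) (hxx : x ⬝ᵥ x = 0) (hyx : y ⬝ᵥ x = 0)
    (hy : y ⬝ᵥ y ≠ 0) {α β : ZMod p} (h : siegelGL x y α = siegelGL x y β) : α = β := by
  obtain ⟨i, hi⟩ : ∃ i, x i ≠ 0 := Function.ne_iff.mp hx0
  have hv : (Pi.single i 1 : V p) ⬝ᵥ x ≠ 0 := by
    rw [dotProduct_comm, dotProduct_single, mul_one]; exact hi
  refine siegel_smul_inj hyx hy hv ?_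
  rw [← siegelGL_mulVec hp2 hxx hyx hy, ← siegelGL_mulVec hp2 hxx hyx hy, h]

/-! ## The class of the mirrors in `x^⊥` -/

/-- **The mirrors of `x^⊥` have the wrong class.**  For `x ≠ 0` isotropic, `y ⊥ x` anisotropic
and `−c` a non-square, `Q(y)` and `c` lie in different square classes (`−Q(y)` is a square by
`ReflectionClassSphere.neg_dot_isSquare_of_perp_isotropic`). -/
theorem not_class_of_perp_isotropic {c : ZMod p} (hc : ¬ IsSquare (-c)) (hx0 : x ≠ 0)
    (hxx : x ⬝ᵥ x = 0) (hyx : y ⬝ᵥ x = 0) (hy : y ⬝ᵥ y ≠ 0) :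
    ¬ (IsSquare (y ⬝ᵥ y) ↔ IsSquare c) := by
  intro h
  obtain ⟨r, hr⟩ := neg_dot_isSquare_of_perp_isotropic hx0 hxx hyx
  apply hc
  by_cases hs : IsSquare (y ⬝ᵥ y)
  · obtain ⟨s, hs'⟩ := hs
    obtain ⟨t, ht⟩ := h.mp ⟨s, hs'⟩
    -- `−c = (−Q y) · c / Q y = (r t / s)²`
    refine ⟨r * t / s, ?_⟩
    have h1 : r * t / s * (r * t / s) = r * r * (t * t) / (s * s) := by ring
    rw [h1, ← hr, ← ht, ← hs', eq_div_iff hy]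
    ring
  · -- both non-squares: `c · Q(y)` is a square
    have hns : ¬ IsSquare c := fun h' => hs (h.mpr h')
    have hc0 : c ≠ 0 := by rintro rfl; exact hns IsSquare.zero
    have hsq : IsSquare (c * (y ⬝ᵥ y)) := by
      rw [← quadraticChar_one_iff_isSquare (mul_ne_zero hc0 hy), map_mul,
        (quadraticChar_neg_one_iff_not_isSquare).mpr hns,
        (quadraticChar_neg_one_iff_not_isSquare).mpr hs]
      norm_num
    obtain ⟨t, ht⟩ := hsq
    -- `−c = (−Q y)(c Q y) / Q(y)² = (r t / Q y)²`
    refine ⟨r * t / (y ⬝ᵥ y), ?_⟩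
    have h1 : r * t / (y ⬝ᵥ y) * (r * t / (y ⬝ᵥ y)) =
        r * r * (t * t) / ((y ⬝ᵥ y) * (y ⬝ᵥ y)) := by ring
    rw [h1, ← hr, ← ht, eq_div_iff (mul_ne_zero hy hy)]
    ring

end Products

end ReflectionClassSiegel
end Summit.MatrixMultiplication.MatrixMultiplication.Theorems.SubgroupIdentityDesigns.Negative
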